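import Summits.QuantumFields.YangMills.Theorems.BalabanUVNodesN18CombStepNearIdentity
import Summits.QuantumFields.YangMills.Theorems.BalabanUVNodesN18AvgRemainderUnitsLipschitz
import Summits.QuantumFields.YangMills.Theorems.BalabanUVNodesN18CombStepRemainderLipschitzPrelim
import HarnessLib

/-!
# BalabanUVNodes ∕ node N18 = NE5 — closure-ledger item (iii), comb step M4c, file (6b):
# THE LINEARISATION REMAINDER OF THE AVERAGED POTENTIAL IS LIPSCHITZ IN THE FIELDS WITH A CONSTANT PROPORTIONAL TO THE RADIUS

(Track A, DAG node N18 = `T4OutputRate.NE5`; cluster K4 «SpineRates», key item K3⁸ `SpineGivenEndpointR13SepCoPHV` (stmt-QuantumFields-27366);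
seat pub-ymgap-dag-n18-w3 g5, INTENT-6 = design step M4c of `COMB-STEP-DESIGN.md` ∕ `COMB-CHAIN-INDEX.md`.)

HONEST FRAMING.  Count-neutral kernel bookkeeping (`--supports stmt-QuantumFields-27366 --as helper`).  The C¹ cancelled sum of the comb step
((4d) `norm_nabla_transported_comb_le`) bounds the coarse covariant derivative of the linearisation remainder `Rem = W − main` CRUDELY by `2‖Rem‖∕ξ`,
which is the one C¹ side term of FILE 7 without `η_j`-decay (`2R∕ξ²`).  The cure (M4c) is a coarse-Lipschitz estimate: `Rem` at the next coarse bond is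
the same functional of the translated fields ((6a) `potRem_translate`), and THIS file proves the functional is Lipschitz in the fields with a constant
carrying the radius `(s + t)` — every piece of the C⁰ chain (I1's `norm_mlog_avgUnits_mul_inv_sub_linAvg_le`) is second order: `log(1+Z) − Z`
((6b-alg) `norm_mlog_sub_sub_mlog_sub_le`), `Z − (Ū(S) − Ū(U₀)) = (Ū(S) − Ū(U₀))(Ū(U₀)⁻¹ − 1)`, the two Prop. 3 remainders (g3's units-carrier Lipschitz
twin `norm_avgRemU_sub_avgRemU_le`, King's Cauchy road), `Q₁((E − 1)(U₀ − 1))`, and the chart `Q₁(e^{iηA} − 1 − iηA)` ((6b-alg)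
`norm_exp_sub_sub_exp_sub_le`).  Constants are NOT optimised (`390000`, `800000`: envelope constants absorbed by the radii bootstrap).  Nothing of
Bałaban's analysis is asserted beyond the cited tree theorems; NE5 NOT printed ∕ NOT proved; N18 NOT discharged; finite tori — nothing about the
continuum ∕ OS ∕ mass gap; YM mass gap (Clay) NOT proved — R4 closes the conditional finite-𝕋⁴ rung `BalabanLadder.UV` only.

WHAT.
* (§1 `norm_logPart_sub_logPart_le`, §2a `mlogRem_envelope`: file `…CombStepRemainderLipschitzPrelim`.)
* §2 ★ `norm_mlogRem_sub_mlogRem_le` — for two factorised triples `S = E·U₀`, `S′ = E′·U₀′` within `(e, t)` of `1` and `(εE, εU)` of each other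
  (all bonds), `384ℓ(s + t) ≤ 1` (`s = e + t + et`, `ℓ = (d+2)L`), `0 < t`:
  `‖[log(Ū(S′)Ū(U₀′)⁻¹) − Q₁(E′ − 1)] − [log(Ū(S)Ū(U₀)⁻¹) − Q₁(E − 1)]‖ ≤ 390000·ℓ²·(s + t)·(εE + εU)`.
* §3 ★★ `norm_potRem_sub_potRem_le` — the same in the letters of the comb step: `S = (exp iηA)·U₀`, `|A|, |A′| ≤ a`, `‖A′ − A‖ ≤ εA`, `ηa ≤ 1∕2`:
  `‖F[S′,U₀′,A′] − F[S,U₀,A]‖ ≤ ξ⁻¹·800000·ℓ²·((2ηa + t + 2ηa·t) + t)·(η·εA + εU)`, `F = (iξ)⁻¹log(Ū(S)Ū(U₀)⁻¹) − (η∕ξ)Q₁A`.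

0 `def`, 0 `sorry`.  References: T. Bałaban, CMP **98** (1985) 17–51 [Balaban1985Averaging] (Prop. 3 (122)–(126) p.36, (21)/(26) pp.21–22, (62)–(63) p.28);
CMP **109** (1987) 249–301 [Balaban1987RG1] ((0.4) p.253, (1.12)–(1.13) p.262); C. King, CMP **102** (1986) 649–677 [King1986] ((3.43)–(3.47) p.661).
-/

noncomputable section

open scoped BigOperators Matrix.Norms.L2Operator
open NormedSpace

namespace YMDAG.N18.TransportOfRecord

open Complex (I)
open Literature.MathematicalPhysics.QuantumFieldTheory.Balaban1983to89
open Literature.MathematicalPhysics.QuantumFieldTheory.Balaban1983to89.T4Continuum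
open Literature.MathematicalPhysics.QuantumFieldTheory.Balaban1983to89.BlockAveraging
open Literature.MathematicalPhysics.QuantumFieldTheory.Balaban1983to89.BlockAveragingEMLLinearised (linAvg)
open Literature.MathematicalPhysics.QuantumFieldTheory.Balaban1983to89.B12RegularSpaces111 (expI)
open Literature.MathematicalPhysics.QuantumFieldTheory.Balaban1983to89.B12Lemma4Concrete (val_expI)
open Literature.MathematicalPhysics.QuantumFieldTheory.Balaban1983to89.B12Membership314 (norm_I_mul_smul)
open Literature.MathematicalPhysics.QuantumFieldTheory.Balaban1983to89.MatrixLog (mlog)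
open Literature.MathematicalPhysics.QuantumFieldTheory.Balaban1983to89.Node00.W1 (avgUnits)
open Summit.QuantumFields.YangMills.Theorems.Prop8Chart (norm_emlAvgU_sub_one_sub_linAvg_le)
open Summit.QuantumFields.YangMills.Theorems.Prop7AvgLinearisation (linAvg_sub norm_linAvg_le)
open YMDAG.N18.AvgRemainderUnits (norm_avgRemU_sub_avgRemU_le)

/-! ## §2 ★ The Lipschitz bound of `log(Ū(S)Ū(U₀)⁻¹) − Q₁(E − 1)` in the factorised fields -/

section Fields

variable {P : Params} {j : ℕ} {n : Type*} [Fintype n] [DecidableEq n] [Nonempty n]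

/-- ★ **THE LINEARISATION REMAINDER OF THE AVERAGED POTENTIAL IS LIPSCHITZ IN THE FIELDS, CONSTANT ∝ RADIUS**: for two factorised fields `S = E·U₀`,
`S′ = E′·U₀′` (bondwise) with `‖E − 1‖, ‖E′ − 1‖ ≤ e`, `‖U₀ − 1‖, ‖U₀′ − 1‖ ≤ t`, `‖E′ − E‖ ≤ ε_E`, `‖U₀′ − U₀‖ ≤ ε_U` on all bonds, `0 < t`,
`384ℓ(s + t) ≤ 1` (`s = e + t + et`, `ℓ = (d+2)L`):
`‖[log(Ū(S′)(c)Ū(U₀′)(c)⁻¹) − Q₁(E′ − 1)(c)] − [log(Ū(S)(c)Ū(U₀)(c)⁻¹) − Q₁(E − 1)(c)]‖ ≤ 390000·ℓ²·(s + t)·(ε_E + ε_U)`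
— I1's C⁰ chain `norm_mlog_avgUnits_mul_inv_sub_linAvg_le` read as a Lipschitz estimate: §1 for the logarithmic part (with `‖Ū(S′) − Ū(S)‖ ≤ (3ℓ + 84480ℓ²(s+t))·‖S′ − S‖`
from `Q₁` and g3's remainder twin), g3's `norm_avgRemU_sub_avgRemU_le` for the two Prop. 3 remainders, `Q₁((E−1)(U₀−1))` bilinear.
[cite: Balaban1985Averaging, Prop. 3 (122)-(126) p.36, (62)-(63) p.28; King1986, (3.43)-(3.47) p.661; Balaban1987RG1, (0.4) p.253] -/
theorem norm_mlogRem_sub_mlogRem_le (hj : j + 1 ≤ P.m + P.K) {E U₀ S E' U₀' S' : GaugeField P j (Matrix n n ℂ)ˣ}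
    (hS : ∀ b, S b = E b * U₀ b) (hS' : ∀ b, S' b = E' b * U₀' b) {e t εE εU : ℝ} (he0 : 0 ≤ e) (ht0 : 0 < t)
    (hεE : 0 ≤ εE) (hεU : 0 ≤ εU)
    (hE : ∀ b, ‖((E b : (Matrix n n ℂ)ˣ) : Matrix n n ℂ) - 1‖ ≤ e) (hE' : ∀ b, ‖((E' b : (Matrix n n ℂ)ˣ) : Matrix n n ℂ) - 1‖ ≤ e)
    (hU : ∀ b, ‖((U₀ b : (Matrix n n ℂ)ˣ) : Matrix n n ℂ) - 1‖ ≤ t) (hU' : ∀ b, ‖((U₀' b : (Matrix n n ℂ)ˣ) : Matrix n n ℂ) - 1‖ ≤ t)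
    (hdE : ∀ b, ‖((E' b : (Matrix n n ℂ)ˣ) : Matrix n n ℂ) - ((E b : (Matrix n n ℂ)ˣ) : Matrix n n ℂ)‖ ≤ εE)
    (hdU : ∀ b, ‖((U₀' b : (Matrix n n ℂ)ˣ) : Matrix n n ℂ) - ((U₀ b : (Matrix n n ℂ)ˣ) : Matrix n n ℂ)‖ ≤ εU)
    (hℓ : 384 * (((P.d + 2) * P.L : ℕ) : ℝ) * ((e + t + e * t) + t) ≤ 1) (c : PBond P (j + 1)) :
    ‖(mlog (((avgUnits S' c : (Matrix n n ℂ)ˣ) : Matrix n n ℂ) * (((avgUnits U₀' c)⁻¹ : (Matrix n n ℂ)ˣ) : Matrix n n ℂ)) -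
          linAvg (fun b => ((E' b : (Matrix n n ℂ)ˣ) : Matrix n n ℂ) - 1) c) -
        (mlog (((avgUnits S c : (Matrix n n ℂ)ˣ) : Matrix n n ℂ) * (((avgUnits U₀ c)⁻¹ : (Matrix n n ℂ)ˣ) : Matrix n n ℂ)) -
          linAvg (fun b => ((E b : (Matrix n n ℂ)ˣ) : Matrix n n ℂ) - 1) c)‖ ≤
      390000 * (((P.d + 2) * P.L : ℕ) : ℝ) ^ 2 * ((e + t + e * t) + t) * (εE + εU) := by
  set ℓ : ℝ := (((P.d + 2) * P.L : ℕ) : ℝ) with hℓdef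
  set s : ℝ := e + t + e * t with hs
  have hℓ1 : (1 : ℝ) ≤ ℓ := by
    rw [hℓdef]; exact_mod_cast Nat.one_le_iff_ne_zero.mpr (Nat.mul_ne_zero (by omega) (by have := P.hL.2; omega))
  have hℓ0 : 0 ≤ ℓ := by linarith
  have het : 0 ≤ e * t := mul_nonneg he0 ht0.le
  have hs0 : 0 ≤ s := by rw [hs]; positivity
  have hst : t ≤ s := by rw [hs]; linarith
  have hes : e ≤ s := by rw [hs]; linarith
  have hσ0 : 0 < s + t := by linarith
  have hℓσ : ℓ * (s + t) ≤ 1 / 384 := by nlinarith only [hℓ]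
  have hσ1 : s + t ≤ 1 / 384 := by nlinarith only [hℓσ, hℓ1, hσ0]
  have ht1 : t ≤ 1 := by linarith
  have he1 : e ≤ 1 := by linarith
  set W : ℝ := εE + εU with hW
  have hW0 : 0 ≤ W := by rw [hW]; positivity
  have hεUW : εU ≤ W := by rw [hW]; linarith
  have hεEW : εE ≤ W := by rw [hW]; linarith
  -- `S`, `S′` within `s` of `1`; `‖S′ − S‖ ≤ 2W`
  have near : ∀ {F V : GaugeField P j (Matrix n n ℂ)ˣ} (b : PBond P j), ‖((F b : (Matrix n n ℂ)ˣ) : Matrix n n ℂ) - 1‖ ≤ e →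
      ‖((V b : (Matrix n n ℂ)ˣ) : Matrix n n ℂ) - 1‖ ≤ t → ‖((F b : (Matrix n n ℂ)ˣ) : Matrix n n ℂ) * ((V b : (Matrix n n ℂ)ˣ) : Matrix n n ℂ) - 1‖ ≤ s :=
    fun {F V} b hF hV => by
    have hid : ((F b : (Matrix n n ℂ)ˣ) : Matrix n n ℂ) * ((V b : (Matrix n n ℂ)ˣ) : Matrix n n ℂ) - 1 =
        (((F b : (Matrix n n ℂ)ˣ) : Matrix n n ℂ) - 1) * (((V b : (Matrix n n ℂ)ˣ) : Matrix n n ℂ) - 1) +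
          ((((F b : (Matrix n n ℂ)ˣ) : Matrix n n ℂ) - 1) + (((V b : (Matrix n n ℂ)ˣ) : Matrix n n ℂ) - 1)) := by noncomm_ring
    rw [hid]
    calc _ ≤ ‖(((F b : (Matrix n n ℂ)ˣ) : Matrix n n ℂ) - 1) * (((V b : (Matrix n n ℂ)ˣ) : Matrix n n ℂ) - 1)‖ +
          ‖(((F b : (Matrix n n ℂ)ˣ) : Matrix n n ℂ) - 1) + (((V b : (Matrix n n ℂ)ˣ) : Matrix n n ℂ) - 1)‖ := norm_add_le _ _
      _ ≤ e * t + (e + t) := add_le_add ((norm_mul_le _ _).trans (mul_le_mul hF hV (norm_nonneg _) he0)) ((norm_add_le _ _).trans (add_le_add hF hV))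
      _ = s := by rw [hs]; ring
  have hSb : ∀ b, ‖((S b : (Matrix n n ℂ)ˣ) : Matrix n n ℂ) - 1‖ ≤ s := fun b => by rw [hS b, Units.val_mul]; exact near b (hE b) (hU b)
  have hSb' : ∀ b, ‖((S' b : (Matrix n n ℂ)ˣ) : Matrix n n ℂ) - 1‖ ≤ s := fun b => by rw [hS' b, Units.val_mul]; exact near b (hE' b) (hU' b)
  have hdS : ∀ b, ‖((S' b : (Matrix n n ℂ)ˣ) : Matrix n n ℂ) - ((S b : (Matrix n n ℂ)ˣ) : Matrix n n ℂ)‖ ≤ 2 * W := fun b => by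
    rw [hS b, hS' b, Units.val_mul, Units.val_mul]
    have hid : ((E' b : (Matrix n n ℂ)ˣ) : Matrix n n ℂ) * ((U₀' b : (Matrix n n ℂ)ˣ) : Matrix n n ℂ) -
        ((E b : (Matrix n n ℂ)ˣ) : Matrix n n ℂ) * ((U₀ b : (Matrix n n ℂ)ˣ) : Matrix n n ℂ) =
        (((E' b : (Matrix n n ℂ)ˣ) : Matrix n n ℂ) - ((E b : (Matrix n n ℂ)ˣ) : Matrix n n ℂ)) * ((U₀' b : (Matrix n n ℂ)ˣ) : Matrix n n ℂ) +
          ((E b : (Matrix n n ℂ)ˣ) : Matrix n n ℂ) * (((U₀' b : (Matrix n n ℂ)ˣ) : Matrix n n ℂ) - ((U₀ b : (Matrix n n ℂ)ˣ) : Matrix n n ℂ)) := by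
      noncomm_ring
    rw [hid]
    have hU'n : ‖((U₀' b : (Matrix n n ℂ)ˣ) : Matrix n n ℂ)‖ ≤ 1 + t := by
      calc ‖((U₀' b : (Matrix n n ℂ)ˣ) : Matrix n n ℂ)‖ = ‖(((U₀' b : (Matrix n n ℂ)ˣ) : Matrix n n ℂ) - 1) + 1‖ := by rw [sub_add_cancel]
        _ ≤ ‖((U₀' b : (Matrix n n ℂ)ˣ) : Matrix n n ℂ) - 1‖ + ‖(1 : Matrix n n ℂ)‖ := norm_add_le _ _
        _ ≤ t + 1 := add_le_add (hU' b) (by rw [norm_one])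
        _ = 1 + t := by ring
    have hEn : ‖((E b : (Matrix n n ℂ)ˣ) : Matrix n n ℂ)‖ ≤ 1 + e := by
      calc ‖((E b : (Matrix n n ℂ)ˣ) : Matrix n n ℂ)‖ = ‖(((E b : (Matrix n n ℂ)ˣ) : Matrix n n ℂ) - 1) + 1‖ := by rw [sub_add_cancel]
        _ ≤ ‖((E b : (Matrix n n ℂ)ˣ) : Matrix n n ℂ) - 1‖ + ‖(1 : Matrix n n ℂ)‖ := norm_add_le _ _
        _ ≤ e + 1 := add_le_add (hE b) (by rw [norm_one])
        _ = 1 + e := by ring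
    calc _ ≤ ‖((E' b : (Matrix n n ℂ)ˣ) : Matrix n n ℂ) - ((E b : (Matrix n n ℂ)ˣ) : Matrix n n ℂ)‖ * ‖((U₀' b : (Matrix n n ℂ)ˣ) : Matrix n n ℂ)‖ +
          ‖((E b : (Matrix n n ℂ)ˣ) : Matrix n n ℂ)‖ * ‖((U₀' b : (Matrix n n ℂ)ˣ) : Matrix n n ℂ) - ((U₀ b : (Matrix n n ℂ)ˣ) : Matrix n n ℂ)‖ :=
          (norm_add_le _ _).trans (add_le_add (norm_mul_le _ _) (norm_mul_le _ _))
      _ ≤ εE * (1 + t) + (1 + e) * εU := add_le_add (mul_le_mul (hdE b) hU'n (norm_nonneg _) hεE) (mul_le_mul hEn (hdU b) (norm_nonneg _) (by linarith))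
      _ ≤ 2 * W := by rw [hW]; nlinarith only [ht1, he1, hεE, hεU, ht0, he0]
  -- Prop. 3 (flat background) for the four fields
  have h48s : 48 * ℓ * s ≤ 1 := by nlinarith only [hℓσ, hℓ0, ht0, hs0]
  have h48t : 48 * ℓ * t ≤ 1 := by nlinarith only [hℓσ, hℓ0, ht0, hs0]
  obtain ⟨-, hX2⟩ := norm_emlAvgU_sub_one_sub_linAvg_le hj (S := S) c hs0 h48s (fun b _ _ => hSb b)
  obtain ⟨-, hY2⟩ := norm_emlAvgU_sub_one_sub_linAvg_le hj (S := U₀) c ht0.le h48t (fun b _ _ => hU b)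
  obtain ⟨-, hX2'⟩ := norm_emlAvgU_sub_one_sub_linAvg_le hj (S := S') c hs0 h48s (fun b _ _ => hSb' b)
  obtain ⟨-, hY2'⟩ := norm_emlAvgU_sub_one_sub_linAvg_le hj (S := U₀') c ht0.le h48t (fun b _ _ => hU' b)
  -- the two remainder twins (radius `s + t`)
  have hRS := norm_avgRemU_sub_avgRemU_le hj c hσ0 (by positivity : (0 : ℝ) ≤ 2 * W) hℓ (S := S) (S' := S')
    (fun b _ _ => (hSb b).trans (by linarith)) (fun b _ _ => (hSb' b).trans (by linarith)) (fun b _ _ => hdS b)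
  have hRU := norm_avgRemU_sub_avgRemU_le hj c hσ0 hεU hℓ (S := U₀) (S' := U₀')
    (fun b _ _ => (hU b).trans (by linarith)) (fun b _ _ => (hU' b).trans (by linarith)) (fun b _ _ => hdU b)
  -- names
  set A : Matrix n n ℂ := ((avgUnits S c : (Matrix n n ℂ)ˣ) : Matrix n n ℂ) with hA
  set B : Matrix n n ℂ := ((avgUnits U₀ c : (Matrix n n ℂ)ˣ) : Matrix n n ℂ) with hB
  set Binv : Matrix n n ℂ := (((avgUnits U₀ c)⁻¹ : (Matrix n n ℂ)ˣ) : Matrix n n ℂ) with hBinv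
  set A' : Matrix n n ℂ := ((avgUnits S' c : (Matrix n n ℂ)ˣ) : Matrix n n ℂ) with hA'
  set B' : Matrix n n ℂ := ((avgUnits U₀' c : (Matrix n n ℂ)ˣ) : Matrix n n ℂ) with hB'
  set Binv' : Matrix n n ℂ := (((avgUnits U₀' c)⁻¹ : (Matrix n n ℂ)ˣ) : Matrix n n ℂ) with hBinv'
  set LS := linAvg (fun b => ((S b : (Matrix n n ℂ)ˣ) : Matrix n n ℂ) - 1) c with hLS
  set LU := linAvg (fun b => ((U₀ b : (Matrix n n ℂ)ˣ) : Matrix n n ℂ) - 1) c with hLU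
  set LE := linAvg (fun b => ((E b : (Matrix n n ℂ)ˣ) : Matrix n n ℂ) - 1) c with hLE
  set LS' := linAvg (fun b => ((S' b : (Matrix n n ℂ)ˣ) : Matrix n n ℂ) - 1) c with hLS'
  set LU' := linAvg (fun b => ((U₀' b : (Matrix n n ℂ)ˣ) : Matrix n n ℂ) - 1) c with hLU'
  set LE' := linAvg (fun b => ((E' b : (Matrix n n ℂ)ˣ) : Matrix n n ℂ) - 1) c with hLE'
  change ‖A - 1‖ ≤ 17 * ℓ * s at hX2
  change ‖B - 1‖ ≤ 17 * ℓ * t at hY2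
  change ‖A' - 1‖ ≤ 17 * ℓ * s at hX2'
  change ‖B' - 1‖ ≤ 17 * ℓ * t at hY2'
  change ‖(A' - 1 - LS') - (A - 1 - LS)‖ ≤ 84480 * ℓ ^ 2 * (s + t) * (2 * W) at hRS
  change ‖(B' - 1 - LU') - (B - 1 - LU)‖ ≤ 84480 * ℓ ^ 2 * (s + t) * εU at hRU
  -- inverses
  have hq : 17 * ℓ * t ≤ 1 / 2 := by nlinarith only [hℓσ, hℓ0, ht0, hs0]
  obtain ⟨hBi1, -⟩ := norm_units_inv_le_of_norm_sub_one_le (u := avgUnits U₀ c) hY2 hq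
  obtain ⟨hBi1', hBi2'⟩ := norm_units_inv_le_of_norm_sub_one_le (u := avgUnits U₀' c) hY2' hq
  change ‖Binv‖ ≤ 2 at hBi1
  change ‖Binv'‖ ≤ 2 at hBi1'
  change ‖Binv' - 1‖ ≤ 2 * (17 * ℓ * t) at hBi2'
  have hBB : B * Binv = 1 := by rw [hB, hBinv, Units.mul_inv]
  have hBB' : B' * Binv' = 1 := by rw [hB', hBinv', Units.mul_inv]
  have hBiB' : Binv' * B' = 1 := by rw [hB', hBinv', Units.inv_mul]
  -- `Ū` is Lipschitz: `Ū(S′) − Ū(S) = (R(S′) − R(S)) + Q₁(S′ − S)`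
  have hLSd : ‖LS' - LS‖ ≤ 3 * ℓ * (2 * W) := by
    rw [hLS', hLS, ← linAvg_sub]
    refine norm_linAvg_le _ (by positivity) (fun b => ?_) c
    rw [sub_sub_sub_cancel_right]; exact hdS b
  have hLUd : ‖LU' - LU‖ ≤ 3 * ℓ * εU := by
    rw [hLU', hLU, ← linAvg_sub]
    refine norm_linAvg_le _ hεU (fun b => ?_) c
    rw [sub_sub_sub_cancel_right]; exact hdU b
  have hdA : ‖A' - A‖ ≤ 84480 * ℓ ^ 2 * (s + t) * (2 * W) + 3 * ℓ * (2 * W) := by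
    have : A' - A = ((A' - 1 - LS') - (A - 1 - LS)) + (LS' - LS) := by abel
    rw [this]; exact (norm_add_le _ _).trans (add_le_add hRS hLSd)
  have hdB : ‖B' - B‖ ≤ 84480 * ℓ ^ 2 * (s + t) * εU + 3 * ℓ * εU := by
    have : B' - B = ((B' - 1 - LU') - (B - 1 - LU)) + (LU' - LU) := by abel
    rw [this]; exact (norm_add_le _ _).trans (add_le_add hRU hLUd)
  have hAB : ‖A - B‖ ≤ 17 * ℓ * (s + t) := by
    have : A - B = (A - 1) - (B - 1) := by abel
    rw [this]; exact (norm_sub_le _ _).trans (by linarith)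
  have hAB' : ‖A' - B'‖ ≤ 17 * ℓ * (s + t) := by
    have : A' - B' = (A' - 1) - (B' - 1) := by abel
    rw [this]; exact (norm_sub_le _ _).trans (by linarith)
  -- §1 for the logarithmic part
  have hlog := norm_logPart_sub_logPart_le (ρ := 17 * ℓ * (s + t)) (τ := 2 * (17 * ℓ * t)) hBB hBB' hBiB' (by positivity)
    (by positivity) (by positivity) hAB hAB' hBi1 hBi1' hBi2' hdA hdB (by nlinarith only [hℓσ])
  -- T4: `LS − LU − LE = Q₁((E−1)(U₀−1))` is bilinear
  have hD : ∀ {F V T : GaugeField P j (Matrix n n ℂ)ˣ}, (∀ b, T b = F b * V b) →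
      linAvg (fun b => ((T b : (Matrix n n ℂ)ˣ) : Matrix n n ℂ) - 1) c - linAvg (fun b => ((V b : (Matrix n n ℂ)ˣ) : Matrix n n ℂ) - 1) c -
        linAvg (fun b => ((F b : (Matrix n n ℂ)ˣ) : Matrix n n ℂ) - 1) c =
      linAvg (fun b => (((F b : (Matrix n n ℂ)ˣ) : Matrix n n ℂ) - 1) * ((((V b : (Matrix n n ℂ)ˣ) : Matrix n n ℂ)) - 1)) c :=
    fun {F V T} hT => by
    rw [← linAvg_sub, ← linAvg_sub]
    congr 1
    funext b
    rw [hT b, Units.val_mul]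
    noncomm_ring
  have hT4 : ‖(LS' - LU' - LE') - (LS - LU - LE)‖ ≤ 3 * ℓ * (εE * t + e * εU) := by
    rw [hLS', hLU', hLE', hLS, hLU, hLE, hD hS', hD hS, ← linAvg_sub]
    refine norm_linAvg_le _ (by positivity) (fun b => ?_) c
    have hid : (((E' b : (Matrix n n ℂ)ˣ) : Matrix n n ℂ) - 1) * (((U₀' b : (Matrix n n ℂ)ˣ) : Matrix n n ℂ) - 1) -
        (((E b : (Matrix n n ℂ)ˣ) : Matrix n n ℂ) - 1) * (((U₀ b : (Matrix n n ℂ)ˣ) : Matrix n n ℂ) - 1) =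
        (((E' b : (Matrix n n ℂ)ˣ) : Matrix n n ℂ) - ((E b : (Matrix n n ℂ)ˣ) : Matrix n n ℂ)) * (((U₀' b : (Matrix n n ℂ)ˣ) : Matrix n n ℂ) - 1) +
          (((E b : (Matrix n n ℂ)ˣ) : Matrix n n ℂ) - 1) * (((U₀' b : (Matrix n n ℂ)ˣ) : Matrix n n ℂ) - ((U₀ b : (Matrix n n ℂ)ˣ) : Matrix n n ℂ)) := by
      noncomm_ring
    rw [hid]
    exact (norm_add_le _ _).trans (add_le_add ((norm_mul_le _ _).trans (mul_le_mul (hdE b) (hU' b) (norm_nonneg _) hεE))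
      ((norm_mul_le _ _).trans (mul_le_mul (hE b) (hdU b) (norm_nonneg _) he0)))
  -- assemble: `G = [log(AB⁻¹) − (A − B)] + [(A − 1 − LS) − (B − 1 − LU)] + [LS − LU − LE]`
  have hsplit : (mlog (A' * Binv') - LE') - (mlog (A * Binv) - LE) =
      ((mlog (A' * Binv') - (A' - B')) - (mlog (A * Binv) - (A - B))) +
        (((A' - 1 - LS') - (A - 1 - LS)) - ((B' - 1 - LU') - (B - 1 - LU))) + ((LS' - LU' - LE') - (LS - LU - LE)) := by abel
  rw [hsplit]
  have hT3 : ‖((A' - 1 - LS') - (A - 1 - LS)) - ((B' - 1 - LU') - (B - 1 - LU))‖ ≤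
      84480 * ℓ ^ 2 * (s + t) * (2 * W) + 84480 * ℓ ^ 2 * (s + t) * εU := (norm_sub_le _ _).trans (add_le_add hRS hRU)
  refine (norm_add₃_le).trans ((add_le_add (add_le_add hlog hT3) hT4).trans ?_)
  -- the scalar envelope
  have hK : 84480 * ℓ ^ 2 * (s + t) ≤ 220 * ℓ := by nlinarith only [hℓσ, hℓ0]
  have hKA : 84480 * ℓ ^ 2 * (s + t) * (2 * W) + 3 * ℓ * (2 * W) ≤ 446 * ℓ * W := by nlinarith only [hK, hW0, hℓ0]
  have hKB : 84480 * ℓ ^ 2 * (s + t) * εU + 3 * ℓ * εU ≤ 223 * ℓ * W := by nlinarith only [hK, hεUW, hεU, hℓ0]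
  exact mlogRem_envelope hℓ1 hσ0.le ht0.le (by linarith only [hst, hs0]) (by linarith only [hes, ht0]) hℓσ hεE hεU hεEW hεUW
    (by positivity) (by positivity) hKA hKB

/-! ## §3 ★★ The same in the letters of the comb step: `S = (exp iηA)·U₀` -/

omit [Nonempty n] in
/-- **The chart is Lipschitz with its second-order remainder**: for `|A(b)|, |A′(b)| ≤ a`, `ηa ≤ 1∕2`, `‖A′(b) − A(b)‖ ≤ ε_A`:
`‖e^{iηA′(b)} − e^{iηA(b)}‖ ≤ 2·η·ε_A` and `‖(e^{iηA′(b)} − 1 − iηA′(b)) − (e^{iηA(b)} − 1 − iηA(b))‖ ≤ 2(ηa)·(η·ε_A)`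
((6b-alg) `norm_exp_sub_sub_exp_sub_le` with `r = ηa`, `e^r ≤ 1 + 2r ≤ 2`). [cite: Balaban1987RG1, (1.13) p.262] -/
theorem norm_expI_sub_expI_le {η a εA : ℝ} (hη : 0 ≤ η) {X X' : Matrix n n ℂ} (hX : ‖X‖ ≤ a) (hX' : ‖X'‖ ≤ a) (hηa : η * a ≤ 1 / 2)
    (hd : ‖X' - X‖ ≤ εA) :
    ‖((expI η X' : (Matrix n n ℂ)ˣ) : Matrix n n ℂ) - ((expI η X : (Matrix n n ℂ)ˣ) : Matrix n n ℂ)‖ ≤ 2 * (η * εA) ∧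
      ‖(((expI η X' : (Matrix n n ℂ)ˣ) : Matrix n n ℂ) - 1 - (I * (η : ℂ)) • X') - (((expI η X : (Matrix n n ℂ)ˣ) : Matrix n n ℂ) - 1 - (I * (η : ℂ)) • X)‖ ≤
        2 * (η * a) * (η * εA) := by
  have ha0 : 0 ≤ a := (norm_nonneg X).trans hX
  have hx : ‖(I * (η : ℂ)) • X‖ ≤ η * a := by rw [norm_I_mul_smul hη]; exact mul_le_mul_of_nonneg_left hX hη
  have hx' : ‖(I * (η : ℂ)) • X'‖ ≤ η * a := by rw [norm_I_mul_smul hη]; exact mul_le_mul_of_nonneg_left hX' hη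
  have hdx : ‖(I * (η : ℂ)) • X' - (I * (η : ℂ)) • X‖ ≤ η * εA := by
    rw [← smul_sub, norm_I_mul_smul hη]; exact mul_le_mul_of_nonneg_left hd hη
  have hηa0 : 0 ≤ η * a := mul_nonneg hη ha0
  have hexp : Real.exp (η * a) ≤ 2 := by
    have h := Real.abs_exp_sub_one_le (x := η * a) (by rw [abs_of_nonneg hηa0]; linarith)
    rw [abs_of_nonneg hηa0] at h
    have := (abs_le.1 h).2
    linarith
  have h2 := norm_exp_sub_sub_exp_sub_le hx' hx
  rw [val_expI, val_expI]
  have hsecond : ‖(NormedSpace.exp ((I * (η : ℂ)) • X') - 1 - (I * (η : ℂ)) • X') - (NormedSpace.exp ((I * (η : ℂ)) • X) - 1 - (I * (η : ℂ)) • X)‖ ≤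
      2 * (η * a) * (η * εA) := by
    refine h2.trans ?_
    have : η * a * Real.exp (η * a) ≤ 2 * (η * a) := by nlinarith [Real.exp_pos (η * a), mul_nonneg hη ha0]
    calc η * a * Real.exp (η * a) * ‖(I * (η : ℂ)) • X' - (I * (η : ℂ)) • X‖ ≤ 2 * (η * a) * (η * εA) :=
          mul_le_mul this hdx (norm_nonneg _) (by positivity)
      _ = 2 * (η * a) * (η * εA) := rfl
  refine ⟨?_, hsecond⟩
  have hid : NormedSpace.exp ((I * (η : ℂ)) • X') - NormedSpace.exp ((I * (η : ℂ)) • X) =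
      ((NormedSpace.exp ((I * (η : ℂ)) • X') - 1 - (I * (η : ℂ)) • X') - (NormedSpace.exp ((I * (η : ℂ)) • X) - 1 - (I * (η : ℂ)) • X)) +
        ((I * (η : ℂ)) • X' - (I * (η : ℂ)) • X) := by abel
  rw [hid]
  refine (norm_add_le _ _).trans ?_
  have hηa1 : 2 * (η * a) ≤ 1 := by linarith
  calc _ ≤ 2 * (η * a) * (η * εA) + η * εA := add_le_add hsecond hdx
    _ ≤ 2 * (η * εA) := by nlinarith [mul_nonneg hη ((norm_nonneg _).trans hd)]

/-- ★★ **THE LINEARISATION REMAINDER OF THE AVERAGED POTENTIAL, IN THE COMB STEP'S LETTERS, IS LIPSCHITZ IN `(A, U₀)` WITH CONSTANT ∝ RADIUS**: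
for `S = (exp iηA)·U₀`, `S′ = (exp iηA′)·U₀′` (bondwise) with `|A|, |A′| ≤ a`, `ηa ≤ 1∕2`, `‖U₀ − 1‖, ‖U₀′ − 1‖ ≤ t` (`0 < t`), `‖A′ − A‖ ≤ ε_A`,
`‖U₀′ − U₀‖ ≤ ε_U` on all bonds, `384ℓ(s + t) ≤ 1` (`s = 2ηa + t + 2ηa·t`) and `ξ > 0`:
`‖F[S′,U₀′,A′](c) − F[S,U₀,A](c)‖ ≤ ξ⁻¹·800000·ℓ²·(s + t)·(η·ε_A + ε_U)`, `F = (iξ)⁻¹log(Ū(S)Ū(U₀)⁻¹) − (η∕ξ)·Q₁A` —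
the coarse-Lipschitz letter of design step M4c: with `ε_A = L(ηa₁ + 2ta)`, `ε_U = 2t`, `s + t = O(η_j)` every factor carries `η_j`.
[cite: Balaban1985Averaging, Prop. 3 (122)-(126) p.36, (62)-(63) p.28; Balaban1987RG1, (0.4) p.253, (1.12)-(1.13) p.262; King1986, (3.43)-(3.47) p.661] -/
theorem norm_potRem_sub_potRem_le (hj : j + 1 ≤ P.m + P.K) {U₀ S U₀' S' : GaugeField P j (Matrix n n ℂ)ˣ} {A A' : PBond P j → Matrix n n ℂ}
    {η ξ a t εA εU : ℝ} (hη : 0 ≤ η) (hξ : 0 < ξ) (hS : ∀ b, S b = expI η (A b) * U₀ b) (hS' : ∀ b, S' b = expI η (A' b) * U₀' b)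
    (hA : ∀ b, ‖A b‖ ≤ a) (hA' : ∀ b, ‖A' b‖ ≤ a) (hηa : η * a ≤ 1 / 2) (ht0 : 0 < t)
    (hU : ∀ b, ‖((U₀ b : (Matrix n n ℂ)ˣ) : Matrix n n ℂ) - 1‖ ≤ t) (hU' : ∀ b, ‖((U₀' b : (Matrix n n ℂ)ˣ) : Matrix n n ℂ) - 1‖ ≤ t)
    (hεA : 0 ≤ εA) (hεU : 0 ≤ εU) (hdA : ∀ b, ‖A' b - A b‖ ≤ εA)
    (hdU : ∀ b, ‖((U₀' b : (Matrix n n ℂ)ˣ) : Matrix n n ℂ) - ((U₀ b : (Matrix n n ℂ)ˣ) : Matrix n n ℂ)‖ ≤ εU)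
    (hℓ : 384 * (((P.d + 2) * P.L : ℕ) : ℝ) * ((2 * (η * a) + t + 2 * (η * a) * t) + t) ≤ 1) (c : PBond P (j + 1)) :
    ‖((I * (ξ : ℂ))⁻¹ • mlog (((avgUnits S' c : (Matrix n n ℂ)ˣ) : Matrix n n ℂ) * (((avgUnits U₀' c)⁻¹ : (Matrix n n ℂ)ˣ) : Matrix n n ℂ)) -
          ((η / ξ : ℝ) : ℂ) • linAvg A' c) -
        ((I * (ξ : ℂ))⁻¹ • mlog (((avgUnits S c : (Matrix n n ℂ)ˣ) : Matrix n n ℂ) * (((avgUnits U₀ c)⁻¹ : (Matrix n n ℂ)ˣ) : Matrix n n ℂ)) -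
          ((η / ξ : ℝ) : ℂ) • linAvg A c)‖ ≤
      ξ⁻¹ * (800000 * (((P.d + 2) * P.L : ℕ) : ℝ) ^ 2 * ((2 * (η * a) + t + 2 * (η * a) * t) + t) * (η * εA + εU)) := by
  set ℓ : ℝ := (((P.d + 2) * P.L : ℕ) : ℝ) with hℓdef
  have hℓ1 : (1 : ℝ) ≤ ℓ := by
    rw [hℓdef]; exact_mod_cast Nat.one_le_iff_ne_zero.mpr (Nat.mul_ne_zero (by omega) (by have := P.hL.2; omega))
  have ha0 : 0 ≤ a := (norm_nonneg _).trans (hA ⟨0, ⟨0, P.hd⟩⟩)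
  have hηa0 : 0 ≤ η * a := mul_nonneg hη ha0
  -- the chart letters
  have he : ∀ b, ‖((expI η (A b) : (Matrix n n ℂ)ˣ) : Matrix n n ℂ) - 1‖ ≤ 2 * (η * a) := fun b =>
    (norm_coe_expI_sub_one_le hη ((mul_le_mul_of_nonneg_left (hA b) hη).trans (by linarith))).trans (by nlinarith [hA b])
  have he' : ∀ b, ‖((expI η (A' b) : (Matrix n n ℂ)ˣ) : Matrix n n ℂ) - 1‖ ≤ 2 * (η * a) := fun b =>
    (norm_coe_expI_sub_one_le hη ((mul_le_mul_of_nonneg_left (hA' b) hη).trans (by linarith))).trans (by nlinarith [hA' b])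
  have hdE : ∀ b, ‖((expI η (A' b) : (Matrix n n ℂ)ˣ) : Matrix n n ℂ) - ((expI η (A b) : (Matrix n n ℂ)ˣ) : Matrix n n ℂ)‖ ≤ 2 * (η * εA) :=
    fun b => (norm_expI_sub_expI_le hη (hA b) (hA' b) hηa (hdA b)).1
  -- ★ for the `G`-part
  have hG := norm_mlogRem_sub_mlogRem_le hj (E := fun b => expI η (A b)) (E' := fun b => expI η (A' b)) hS hS' (by positivity) ht0
    (by positivity : (0 : ℝ) ≤ 2 * (η * εA)) hεU he he' hU hU' hdE hdU hℓ c
  -- T5: the chart linearised inside `Q₁`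
  set LE := linAvg (fun b => ((expI η (A b) : (Matrix n n ℂ)ˣ) : Matrix n n ℂ) - 1) c with hLE
  set LE' := linAvg (fun b => ((expI η (A' b) : (Matrix n n ℂ)ˣ) : Matrix n n ℂ) - 1) c with hLE'
  have hT5 : ‖(LE' - (I * (η : ℂ)) • linAvg A' c) - (LE - (I * (η : ℂ)) • linAvg A c)‖ ≤ 3 * ℓ * (2 * (η * a) * (η * εA)) := by
    have heq : linAvg (fun b => ((((expI η (A' b) : (Matrix n n ℂ)ˣ) : Matrix n n ℂ) - 1) - (I * (η : ℂ)) • A' b) -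
        ((((expI η (A b) : (Matrix n n ℂ)ˣ) : Matrix n n ℂ) - 1) - (I * (η : ℂ)) • A b)) c =
        (LE' - (I * (η : ℂ)) • linAvg A' c) - (LE - (I * (η : ℂ)) • linAvg A c) := by
      rw [hLE', hLE, ← linAvg_smul, ← linAvg_smul, ← linAvg_sub, ← linAvg_sub, ← linAvg_sub]
    rw [← heq]
    exact norm_linAvg_le _ (by positivity) (fun b => (norm_expI_sub_expI_le hη (hA b) (hA' b) hηa (hdA b)).2) c
  -- divide by `iξ` and assemble
  have hIξ : (I * (ξ : ℂ)) ≠ 0 := mul_ne_zero Complex.I_ne_zero (by exact_mod_cast hξ.ne')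
  have hscal : ∀ Q : Matrix n n ℂ, ((η / ξ : ℝ) : ℂ) • Q = (I * (ξ : ℂ))⁻¹ • ((I * (η : ℂ)) • Q) := fun Q => by
    rw [smul_smul]; congr 1; field_simp; push_cast; ring
  rw [hscal (linAvg A' c), hscal (linAvg A c), ← smul_sub, ← smul_sub, ← smul_sub, norm_smul, norm_inv, norm_mul, Complex.norm_I, one_mul,
    Complex.norm_real, Real.norm_of_nonneg hξ.le]
  refine mul_le_mul_of_nonneg_left ?_ (inv_nonneg.mpr hξ.le)
  generalize hM'x : mlog (((avgUnits S' c : (Matrix n n ℂ)ˣ) : Matrix n n ℂ) * (((avgUnits U₀' c)⁻¹ : (Matrix n n ℂ)ˣ) : Matrix n n ℂ)) = M' at hG ⊢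
  generalize hMx : mlog (((avgUnits S c : (Matrix n n ℂ)ˣ) : Matrix n n ℂ) * (((avgUnits U₀ c)⁻¹ : (Matrix n n ℂ)ˣ) : Matrix n n ℂ)) = M at hG ⊢
  have hsplit : (M' - (I * (η : ℂ)) • linAvg A' c) - (M - (I * (η : ℂ)) • linAvg A c) =
      ((M' - LE') - (M - LE)) + ((LE' - (I * (η : ℂ)) • linAvg A' c) - (LE - (I * (η : ℂ)) • linAvg A c)) := by abel
  rw [hsplit]
  refine (norm_add_le _ _).trans ((add_le_add hG hT5).trans ?_)
  -- scalar envelope: `390000ℓ²σ(2ηε_A + ε_U) + 6ℓ(ηa)(ηε_A) ≤ 800000ℓ²σ(ηε_A + ε_U)`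
  have hσa : 2 * (η * a) ≤ (2 * (η * a) + t + 2 * (η * a) * t) + t := by nlinarith
  have hℓ0 : 0 ≤ ℓ := by linarith
  have hσ0 : 0 ≤ (2 * (η * a) + t + 2 * (η * a) * t) + t := by positivity
  have h1 : 3 * ℓ * (2 * (η * a) * (η * εA)) ≤ 3 * ℓ ^ 2 * ((2 * (η * a) + t + 2 * (η * a) * t) + t) * (η * εA) := by
    have hb : ℓ * (2 * (η * a)) ≤ ℓ ^ 2 * ((2 * (η * a) + t + 2 * (η * a) * t) + t) := by
      have h₁ := mul_le_mul_of_nonneg_left hσa hℓ0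
      have h₂ := mul_le_mul_of_nonneg_right hℓ1 (mul_nonneg hℓ0 hσ0)
      nlinarith
    have := mul_le_mul_of_nonneg_right hb (mul_nonneg hη hεA)
    nlinarith
  nlinarith [mul_nonneg (mul_nonneg (sq_nonneg ℓ) hσ0) (mul_nonneg hη hεA), mul_nonneg (mul_nonneg (sq_nonneg ℓ) hσ0) hεU]


end Fields

end YMDAG.N18.TransportOfRecord

end
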